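import Summits.AtomisticToContinuum.Crystallization.Theorems.FrustratedLawDichotomyStrainedPatchPairTubeRecord

/-!
# Strained patch — the GRADED RECORD variant of the pair-tube E-cell (three host classes), critic row 1441 (A)(2)

(HOME-only rider of lens-5 g84; imports the record numerals file `…PairTubeRecord` (v3.2).  Census-gated: the FZ62 / HM62 literals below are DESK
NEEDS ×1.1 (bondprof c6a35e4c on the record family's worst wadv2 members) and are PROVISIONAL until census fixes them from its member sets and the two
owed certg claims report; the FZ09-class literal `(197/10000, 49/5000)` is the CERTIFIED record cone (certg rev 4, j347705: ≥ +20.2 % S_hom).)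

If the constant record cone certifies on FZ62 and HM62 too, the landing form is the constant cell `tubeFloorGBRec_cone` of `…PairTubeRecord` §2 and
this file is not needed.  If either host FAILS at the constant cone, the record E-cell becomes HOST-GRADED: three classes
  · class 1 «low level»      `𝓟₁ = lowLevel ηP`  (centre `GoodAtScale ηP (3/2)`, e.g. FZ09 at level 0.009)         box `(β₁, s₁) = (197/10000, 49/5000)` CERTIFIED,
  · class 2 «rough, fcc»     `¬𝓟₁ ∧ 𝓟₂`, `𝓟₂ = fccCentred ηW` (centre `FccGoodAtScale ηW (3/2)`; FZ62 at 0.062)  box `(β₂, s₂) = (131/10000, 131/20000)` OWED (census j347715 literal = need ×1.1 rounded up; x8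
                             neighbour `(1/80, 63/10000)` certified ≥ +14.7),
  · class 3 «rough, not fcc» `¬𝓟₁ ∧ ¬𝓟₂` (hcp-centred; HM62 at 0.0624)                                        box = FLAT cell `(β₃, s₃) = (239/10000, 0)` (HM62 PH62F, row 1397 T-need 0.0217 × 1.1; E ≥ +15.8 %% Z, census j347715),
and the ONE typed cell is `TubeFloorGBRecBy 𝓘 (grade3 𝓟₁ 𝓟₂ β₁ β₂ β₃) (grade3 𝓟₁ 𝓟₂ s₁ s₂ s₃)`, obtained from the three per-class CONSTANT cells by two
applications of `tubeFloorGB_relConeBy_stepF` (§1); [CORE-FAR] of record and at any core radius follow by `coreOff_record_of_pairTubeRecBy` /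
`coreOff_at_of_pairTubeRecBy` (§2); §3 names the candidate class predicates and the provisional record instance.  The level cut `ηP` and the class
literals are PARAMETERS here (fixed at landing by the census cells; critic verifies by bytes).  [formal bookkeeping] 0 sorry.
-/

noncomputable section

open scoped BigOperators Classical
open Summit.AtomisticToContinuum.Crystallization.Theorems.ChargedEnergyGapNegative (eStar E3)
open Summit.AtomisticToContinuum.Crystallization.Theorems.FrustratedLawDichotomyRangeCut
open Summit.AtomisticToContinuum.Crystallization.Theorems.FrustratedLawDichotomySchurCut
open Summit.AtomisticToContinuum.Crystallization.Theorems.FrustratedLawDichotomyMotifLemmas (GoodAtScale)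
open Summit.AtomisticToContinuum.Crystallization.Theorems.FrustratedLawDichotomyAveragingCut (ballAvg)
open Summit.AtomisticToContinuum.Crystallization.Theorems.FrustratedLawDichotomyExemptLocOpt (LocOptFails)
open Summit.AtomisticToContinuum.Crystallization.Theorems.FrustratedLawDichotomyExemptSplit (SchurElasticPricingX)
open Summit.AtomisticToContinuum.Crystallization.Theorems.FrustratedLawDichotomyExemptAbsorptionRecord
open Summit.AtomisticToContinuum.Crystallization.Theorems.FrustratedLawDichotomyCollarCensus
open Summit.AtomisticToContinuum.Crystallization.Theorems.FrustratedLawDichotomyCollarCensusKappa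
open Summit.AtomisticToContinuum.Crystallization.Theorems.FrustratedLawDichotomyStrainedPatchHomSplit
open Summit.AtomisticToContinuum.Crystallization.Theorems.FrustratedLawDichotomyStrainedPatchCleanCollar (CleanBall TailPenalty AnnularDefectFloor
  DefectiveCollarFloor)
open Summit.AtomisticToContinuum.Crystallization.Theorems.FrustratedLawDichotomyStrainedPatchPhaseCut (MonoPhaseBall AnnularPhaseFloor PolyTextureFloor
  monoPhaseBall_comp_iff FccGoodAtScale)
open Summit.AtomisticToContinuum.Crystallization.Theorems.FrustratedLawDichotomyStrainedPatchCoreTube (NearHomIsoAt CoreOffTubeFloor nearHomIsoAt_comp_iff)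
open Summit.AtomisticToContinuum.Crystallization.Theorems.FrustratedLawDichotomyStrainedPatchCoreTubeRecord (CoreCoreRelief)
open Summit.AtomisticToContinuum.Crystallization.Theorems.FrustratedLawDichotomyStrainedPatchStrainBands (EdgeFarFloor coreOff_iff_edge_and_soft
  softFarFloor_eighth)
open Summit.AtomisticToContinuum.Crystallization.Theorems.FrustratedLawDichotomyStrainedPatchHomIsometry (admissible_comp_iff goodAtScale_comp_iff
  dist_comp injective_comp_iff)
open Summit.AtomisticToContinuum.Crystallization.Theorems.FrustratedLawDichotomyStrainedPatchHomTubeIso (cleanBall_comp_iff ballAvg_xRec_comp)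
open Summit.AtomisticToContinuum.Crystallization.Theorems.FrustratedLawDichotomyStrainedPatchChartFamilies (ChartBy FamilyLE familyLE_refl
  ChartBy.mono_t ChartBy.mono_family)
open Summit.AtomisticToContinuum.Crystallization.Theorems.FrustratedLawDichotomyStrainedPatchHostCells (TubeFloor FamilyCover FamP)
open Summit.AtomisticToContinuum.Crystallization.Theorems.FrustratedLawDichotomyStrainedPatchQuantSlaving (ChartFam SlackTab)
open Summit.AtomisticToContinuum.Crystallization.Theorems.FrustratedLawDichotomyStrainedPatchGradedTube
open Summit.AtomisticToContinuum.Crystallization.Theorems.FrustratedLawDichotomyStrainedPatchCoverBridge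
open Summit.AtomisticToContinuum.Crystallization.Theorems.FrustratedLawDichotomyAperiodicGapRecordJunctionCore
  (aperiodicFrustratedLawGap_of_homFloor_625_of_coreOff periodicFrustratedLawGap_of_homFloor_625_of_coreOff)

namespace Summit.AtomisticToContinuum.Crystallization.Theorems.FrustratedLawDichotomyStrainedPatchPairTube

/-! ## §1. Three-class grading of the E-cell -/

/-- The constant host functional. -/
def constF (x : ℝ) : (M₀ : ℕ) → (Fin M₀ → E3) → Fin M₀ → ℝ := fun _ _ _ => x

/-- ★ `grade3 𝓟₁ 𝓟₂ x₁ x₂ x₃` — `x₁` on the class `𝓟₁`, `x₂` on `¬𝓟₁ ∧ 𝓟₂`, `x₃` on `¬𝓟₁ ∧ ¬𝓟₂` (two nested `stepByF`). -/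
def grade3 (𝓟₁ 𝓟₂ : ChartFam) (x₁ x₂ x₃ : ℝ) : (M₀ : ℕ) → (Fin M₀ → E3) → Fin M₀ → ℝ :=
  stepByF 𝓟₁ (constF x₁) (stepByF 𝓟₂ (constF x₂) (constF x₃))

/-- `grade3` on the first class. [formal bookkeeping] -/
theorem grade3_of_one {𝓟₁ 𝓟₂ : ChartFam} {x₁ x₂ x₃ : ℝ} {M₀ : ℕ} {z₀ : Fin M₀ → E3} {c₀ : Fin M₀} (h₁ : 𝓟₁ M₀ z₀ c₀) :
    grade3 𝓟₁ 𝓟₂ x₁ x₂ x₃ M₀ z₀ c₀ = x₁ := by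
  simp only [grade3, stepByF_of_pos h₁, constF]

/-- `grade3` on the second class. [formal bookkeeping] -/
theorem grade3_of_two {𝓟₁ 𝓟₂ : ChartFam} {x₁ x₂ x₃ : ℝ} {M₀ : ℕ} {z₀ : Fin M₀ → E3} {c₀ : Fin M₀} (h₁ : ¬𝓟₁ M₀ z₀ c₀) (h₂ : 𝓟₂ M₀ z₀ c₀) :
    grade3 𝓟₁ 𝓟₂ x₁ x₂ x₃ M₀ z₀ c₀ = x₂ := by
  simp only [grade3, stepByF_of_neg h₁, stepByF_of_pos h₂, constF]

/-- `grade3` on the third class. [formal bookkeeping] -/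
theorem grade3_of_three {𝓟₁ 𝓟₂ : ChartFam} {x₁ x₂ x₃ : ℝ} {M₀ : ℕ} {z₀ : Fin M₀ → E3} {c₀ : Fin M₀} (h₁ : ¬𝓟₁ M₀ z₀ c₀) (h₂ : ¬𝓟₂ M₀ z₀ c₀) :
    grade3 𝓟₁ 𝓟₂ x₁ x₂ x₃ M₀ z₀ c₀ = x₃ := by
  simp only [grade3, stepByF_of_neg h₁, stepByF_of_neg h₂, constF]

/-- ★★ THE GRADED RECORD E-CELL from three per-class CONSTANT cells (two applications of `tubeFloorGB_relConeBy_stepF`). [formal bookkeeping] -/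
theorem tubeFloorGBRecBy_grade3_of_classes {𝓘 𝓟₁ 𝓟₂ : ChartFam} {β₁ β₂ β₃ s₁ s₂ s₃ : ℝ}
    (h₁ : TubeFloorGBRec (fun M₀ z₀ c₀ => 𝓘 M₀ z₀ c₀ ∧ 𝓟₁ M₀ z₀ c₀) β₁ s₁)
    (h₂ : TubeFloorGBRec (fun M₀ z₀ c₀ => (𝓘 M₀ z₀ c₀ ∧ ¬𝓟₁ M₀ z₀ c₀) ∧ 𝓟₂ M₀ z₀ c₀) β₂ s₂)
    (h₃ : TubeFloorGBRec (fun M₀ z₀ c₀ => (𝓘 M₀ z₀ c₀ ∧ ¬𝓟₁ M₀ z₀ c₀) ∧ ¬𝓟₂ M₀ z₀ c₀) β₃ s₃) :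
    TubeFloorGBRecBy 𝓘 (grade3 𝓟₁ 𝓟₂ β₁ β₂ β₃) (grade3 𝓟₁ 𝓟₂ s₁ s₂ s₃) :=
  tubeFloorGB_relConeBy_stepF (βf₁ := constF β₁) (sf₁ := constF s₁) h₁
    (tubeFloorGB_relConeBy_stepF (βf₁ := constF β₂) (sf₁ := constF s₂) (βf₂ := constF β₃) (sf₂ := constF s₃) h₂ h₃)

/-- Conversely the graded cell RESTRICTS to each class at that class's constant box. [formal bookkeeping] -/
theorem tubeFloorGBRec_classOne_of_grade3 {𝓘 𝓟₁ 𝓟₂ : ChartFam} {β₁ β₂ β₃ s₁ s₂ s₃ : ℝ}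
    (h : TubeFloorGBRecBy 𝓘 (grade3 𝓟₁ 𝓟₂ β₁ β₂ β₃) (grade3 𝓟₁ 𝓟₂ s₁ s₂ s₃)) :
    TubeFloorGBRec (fun M₀ z₀ c₀ => 𝓘 M₀ z₀ c₀ ∧ 𝓟₁ M₀ z₀ c₀) β₁ s₁ := by
  intro M z c M₀ z₀ c₀ e hz hcl hm hch
  have hp : 𝓟₁ M₀ z₀ c₀ := hch.1.1.1.2
  refine h M z c M₀ z₀ c₀ e hz hcl hm ((hch.congr_pair fun a b => ?_).mono_family fun _ _ _ hI => hI.1)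
  simp only [relConeBy, grade3_of_one hp]

/-! ## §2. [CORE-FAR] from the graded record cell -/

/-- ★ [CORE-FAR] of record from the three per-class E-cells and the graded T-cells. [formal bookkeeping] -/
theorem coreOff_record_of_grade3 {𝓘₀ 𝓘 𝓟₁ 𝓟₂ : ChartFam} {β₁ β₂ β₃ s₁ s₂ s₃ : ℝ}
    (h₁ : TubeFloorGBRec (fun M₀ z₀ c₀ => 𝓘 M₀ z₀ c₀ ∧ 𝓟₁ M₀ z₀ c₀) β₁ s₁)
    (h₂ : TubeFloorGBRec (fun M₀ z₀ c₀ => (𝓘 M₀ z₀ c₀ ∧ ¬𝓟₁ M₀ z₀ c₀) ∧ 𝓟₂ M₀ z₀ c₀) β₂ s₂)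
    (h₃ : TubeFloorGBRec (fun M₀ z₀ c₀ => (𝓘 M₀ z₀ c₀ ∧ ¬𝓟₁ M₀ z₀ c₀) ∧ ¬𝓟₂ M₀ z₀ c₀) β₃ s₃)
    (hK : FamilyCoverGRec 𝓘₀) (hD : RefineGBRecBy 𝓘₀ 𝓘 (grade3 𝓟₁ 𝓟₂ β₁ β₂ β₃) (grade3 𝓟₁ 𝓟₂ s₁ s₂ s₃)) :
    CoreOffTubeFloor (63 / 10) (63 / 10) (24 / 5) (1 / 100) 0 :=
  coreOff_record_of_pairTubeRecBy (tubeFloorGBRecBy_grade3_of_classes h₁ h₂ h₃) hK hD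

/-- ★ … and at ANY core radius (route (F): `ρ = 26/5`). [formal bookkeeping] -/
theorem coreOff_at_of_grade3 {𝓘₀ 𝓘 𝓟₁ 𝓟₂ : ChartFam} {ρ ε β₁ β₂ β₃ s₁ s₂ s₃ : ℝ}
    (h₁ : TubeFloorGBRec (fun M₀ z₀ c₀ => 𝓘 M₀ z₀ c₀ ∧ 𝓟₁ M₀ z₀ c₀) β₁ s₁)
    (h₂ : TubeFloorGBRec (fun M₀ z₀ c₀ => (𝓘 M₀ z₀ c₀ ∧ ¬𝓟₁ M₀ z₀ c₀) ∧ 𝓟₂ M₀ z₀ c₀) β₂ s₂)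
    (h₃ : TubeFloorGBRec (fun M₀ z₀ c₀ => (𝓘 M₀ z₀ c₀ ∧ ¬𝓟₁ M₀ z₀ c₀) ∧ ¬𝓟₂ M₀ z₀ c₀) β₃ s₃)
    (hK : FamilyCoverGRecAt 𝓘₀ ρ ε) (hD : RefineGBRecByAt 𝓘₀ 𝓘 ρ ε (grade3 𝓟₁ 𝓟₂ β₁ β₂ β₃) (grade3 𝓟₁ 𝓟₂ s₁ s₂ s₃)) :
    CoreOffTubeFloor (63 / 10) (63 / 10) ρ ε 0 :=
  coreOff_at_of_pairTubeRecBy (tubeFloorGBRecBy_grade3_of_classes h₁ h₂ h₃) hK hD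

/-! ## §3. Candidate host classes and the provisional record instance -/

/-- Class predicate «low level»: the host's centre is `ηP`-good at scale `3/2` (= `levelClass ηP` of …TaylorKbandMinusD). -/
def lowLevel (ηP : ℝ) : ChartFam := fun _ z₀ c₀ => GoodAtScale ηP (3 / 2) z₀ c₀

/-- Class predicate «fcc-centred» at level cap `ηW`: the host's centre fits the CUBOCTAHEDRAL pattern. -/
def fccCentred (ηW : ℝ) : ChartFam := fun _ z₀ c₀ => FccGoodAtScale ηW (3 / 2) z₀ c₀

/-- The PROVISIONAL graded record literals: β by class (FZ09-class certified; FZ62-class and HM62-class = desk need ×1.1, owed). -/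
def recordGradedBox (ηP ηW : ℝ) : (M₀ : ℕ) → (Fin M₀ → E3) → Fin M₀ → ℝ :=
  grade3 (lowLevel ηP) (fccCentred ηW) (197 / 10000) (131 / 10000) (239 / 10000)

/-- The PROVISIONAL graded record literals: cone slope `s` by class. -/
def recordGradedSlope (ηP ηW : ℝ) : (M₀ : ℕ) → (Fin M₀ → E3) → Fin M₀ → ℝ :=
  grade3 (lowLevel ηP) (fccCentred ηW) (49 / 5000) (131 / 20000) 0

/-- ★ The graded record E-cell from the three class cells (FZ09-class at the certified record cone; FZ62-class and HM62-class at their provisional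
cones). [formal bookkeeping] -/
theorem tubeFloorGBRecBy_recordGraded_of_cells {𝓘 : ChartFam} {ηP ηW : ℝ}
    (h₁ : TubeFloorGBRec (fun M₀ z₀ c₀ => 𝓘 M₀ z₀ c₀ ∧ lowLevel ηP M₀ z₀ c₀) (197 / 10000) (49 / 5000))
    (h₂ : TubeFloorGBRec (fun M₀ z₀ c₀ => (𝓘 M₀ z₀ c₀ ∧ ¬lowLevel ηP M₀ z₀ c₀) ∧ fccCentred ηW M₀ z₀ c₀) (131 / 10000) (131 / 20000))
    (h₃ : TubeFloorGBRec (fun M₀ z₀ c₀ => (𝓘 M₀ z₀ c₀ ∧ ¬lowLevel ηP M₀ z₀ c₀) ∧ ¬fccCentred ηW M₀ z₀ c₀) (239 / 10000) 0) :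
    TubeFloorGBRecBy 𝓘 (recordGradedBox ηP ηW) (recordGradedSlope ηP ηW) :=
  tubeFloorGBRecBy_grade3_of_classes h₁ h₂ h₃

/-- The graded literals are everywhere BELOW the constant record cone (so the graded T-cell is the stronger ask and the graded E-cell the weaker).
[formal bookkeeping] -/
theorem recordGradedBox_le (ηP ηW : ℝ) (M₀ : ℕ) (z₀ : Fin M₀ → E3) (c₀ : Fin M₀) : recordGradedBox ηP ηW M₀ z₀ c₀ ≤ 239 / 10000 := by
  unfold recordGradedBox grade3 stepByF constF
  split_ifs <;> norm_num

/-- The graded slope is at most the record slope `49/5000`. [formal bookkeeping] -/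
theorem recordGradedSlope_le (ηP ηW : ℝ) (M₀ : ℕ) (z₀ : Fin M₀ → E3) (c₀ : Fin M₀) : recordGradedSlope ηP ηW M₀ z₀ c₀ ≤ 49 / 5000 := by
  unfold recordGradedSlope grade3 stepByF constF
  split_ifs <;> norm_num

/-- The graded slope is non-negative. [formal bookkeeping] -/
theorem recordGradedSlope_nonneg (ηP ηW : ℝ) (M₀ : ℕ) (z₀ : Fin M₀ → E3) (c₀ : Fin M₀) : 0 ≤ recordGradedSlope ηP ηW M₀ z₀ c₀ := by
  unfold recordGradedSlope grade3 stepByF constF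
  split_ifs <;> norm_num

/-- Family restriction of a record cell. [formal bookkeeping] -/
theorem tubeFloorGBRec_mono_family {𝓘 𝓘' : ChartFam} {β s : ℝ} (hle : FamilyLE 𝓘' 𝓘) (h : TubeFloorGBRec 𝓘 β s) :
    TubeFloorGBRec 𝓘' β s :=
  fun M z c M₀ z₀ c₀ e hz hcl hm hch => h M z c M₀ z₀ c₀ e hz hcl hm (hch.mono_family hle)

/-- `grade3` is monotone in its three values. [formal bookkeeping] -/
theorem grade3_le_grade3 {𝓟₁ 𝓟₂ : ChartFam} {x₁ x₂ x₃ y₁ y₂ y₃ : ℝ} (h₁ : x₁ ≤ y₁) (h₂ : x₂ ≤ y₂) (h₃ : x₃ ≤ y₃)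
    (M₀ : ℕ) (z₀ : Fin M₀ → E3) (c₀ : Fin M₀) : grade3 𝓟₁ 𝓟₂ x₁ x₂ x₃ M₀ z₀ c₀ ≤ grade3 𝓟₁ 𝓟₂ y₁ y₂ y₃ M₀ z₀ c₀ := by
  unfold grade3 stepByF constF
  split_ifs <;> assumption

/-- The ENVELOPE cell: record cone on classes 1–2, record flat on class 3. [formal bookkeeping] -/
theorem tubeFloorGBRecBy_envelope_of_cone_of_flat {𝓘 𝓟₁ 𝓟₂ : ChartFam} (hc : TubeFloorGBRec 𝓘 (197 / 10000) (49 / 5000))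
    (hf : TubeFloorGBRec 𝓘 (43 / 1000) 0) :
    TubeFloorGBRecBy 𝓘 (grade3 𝓟₁ 𝓟₂ (197 / 10000) (197 / 10000) (43 / 1000)) (grade3 𝓟₁ 𝓟₂ (49 / 5000) (49 / 5000) 0) :=
  tubeFloorGBRecBy_grade3_of_classes (tubeFloorGBRec_mono_family (fun _ _ _ hI => hI.1) hc)
    (tubeFloorGBRec_mono_family (fun _ _ _ hI => hI.1.1) hc) (tubeFloorGBRec_mono_family (fun _ _ _ hI => hI.1.1) hf)

/-- SANITY: the two CONSTANT record cells of FZ09 (cone `(197/10000, 49/5000)` AND flat `43/1000`, both certified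
there) imply the graded cell — the graded literals never ask more of a host class than FZ09's record cells do. -/
theorem tubeFloorGBRecBy_recordGraded_of_cone_of_flat {𝓘 : ChartFam} {ηP ηW : ℝ} (hc : TubeFloorGBRec 𝓘 (197 / 10000) (49 / 5000))
    (hf : TubeFloorGBRec 𝓘 (43 / 1000) 0) : TubeFloorGBRecBy 𝓘 (recordGradedBox ηP ηW) (recordGradedSlope ηP ηW) := by
  have hG := tubeFloorGBRecBy_envelope_of_cone_of_flat (𝓟₁ := lowLevel ηP) (𝓟₂ := fccCentred ηW) hc hf
  intro M z c M₀ z₀ c₀ e hz hcl hm hch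
  refine hG M z c M₀ z₀ c₀ e hz hcl hm ⟨hch.1, fun a b ha hb => (hch.2 a b ha hb).trans ?_⟩
  refine relConeBy_mono (RE := 2) (τ₀ := 1 / 25) (βf := recordGradedBox ηP ηW) (sf := recordGradedSlope ηP ηW)
    (βf' := grade3 (lowLevel ηP) (fccCentred ηW) (197 / 10000) (197 / 10000) (43 / 1000))
    (sf' := grade3 (lowLevel ηP) (fccCentred ηW) (49 / 5000) (49 / 5000) 0)
    (fun M₀ z₀ c₀ => grade3_le_grade3 (by norm_num) (by norm_num) (by norm_num) M₀ z₀ c₀)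
    (fun M₀ z₀ c₀ => grade3_le_grade3 (by norm_num) (by norm_num) (by norm_num) M₀ z₀ c₀)
    (fun M₀ z₀ c₀ => ?_) (fun M₀ z₀ c₀ => ?_) M₀ z₀ c₀ (e a) (e b)
  · unfold grade3 stepByF constF
    split_ifs <;> norm_num
  · unfold grade3 stepByF constF
    split_ifs <;> norm_num

/-! ## §5 The host-graded record line, composed BY NAME

The three E-cells (one per host class, literals = the census-certified boxes: FZ09-class
`(197/10000, 49/5000)` certified j347711; FZ62-class `(131/10000, 131/20000)` = P62R and
HM62-class FLAT `239/10000` = PH62F (the HM62 record cone PH62R being thin at E1Z), census j347715/j347725) + the record cover + the graded T-cell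
give the T-leaf target `CoreOffTubeFloor (63/10) (63/10) (24/5) (1/100) 0`, the route-(F)
target at `26/5`, and the crux `AperiodicFrustratedLawGap` through the tree junction
`aperiodicFrustratedLawGap_of_homFloor_625_of_pairTubeRecBy` (…PairTubeRecord). -/

/-- [CORE-FAR] T-leaf target of record from the host-graded record cells. -/
theorem coreOff_record_of_recordGraded {𝓘₀ 𝓘 : ChartFam} {ηP ηW : ℝ}
    (h₁ : TubeFloorGBRec (fun M₀ z₀ c₀ => 𝓘 M₀ z₀ c₀ ∧ lowLevel ηP M₀ z₀ c₀) (197 / 10000) (49 / 5000))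
    (h₂ : TubeFloorGBRec (fun M₀ z₀ c₀ => (𝓘 M₀ z₀ c₀ ∧ ¬lowLevel ηP M₀ z₀ c₀) ∧ fccCentred ηW M₀ z₀ c₀) (131 / 10000) (131 / 20000))
    (h₃ : TubeFloorGBRec (fun M₀ z₀ c₀ => (𝓘 M₀ z₀ c₀ ∧ ¬lowLevel ηP M₀ z₀ c₀) ∧ ¬fccCentred ηW M₀ z₀ c₀) (239 / 10000) 0)
    (hK : FamilyCoverGRec 𝓘₀) (hD : RefineGBRecBy 𝓘₀ 𝓘 (recordGradedBox ηP ηW) (recordGradedSlope ηP ηW)) :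
    CoreOffTubeFloor (63 / 10) (63 / 10) (24 / 5) (1 / 100) 0 :=
  coreOff_record_of_pairTubeRecBy (tubeFloorGBRecBy_recordGraded_of_cells h₁ h₂ h₃) hK hD

/-- Route (F): the same E-cells (they are `ρ`-blind) + the cover and graded T-cell at `ρ = 26/5`. -/
theorem coreOff_26_5_of_recordGraded {𝓘₀ 𝓘 : ChartFam} {ηP ηW : ℝ}
    (h₁ : TubeFloorGBRec (fun M₀ z₀ c₀ => 𝓘 M₀ z₀ c₀ ∧ lowLevel ηP M₀ z₀ c₀) (197 / 10000) (49 / 5000))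
    (h₂ : TubeFloorGBRec (fun M₀ z₀ c₀ => (𝓘 M₀ z₀ c₀ ∧ ¬lowLevel ηP M₀ z₀ c₀) ∧ fccCentred ηW M₀ z₀ c₀) (131 / 10000) (131 / 20000))
    (h₃ : TubeFloorGBRec (fun M₀ z₀ c₀ => (𝓘 M₀ z₀ c₀ ∧ ¬lowLevel ηP M₀ z₀ c₀) ∧ ¬fccCentred ηW M₀ z₀ c₀) (239 / 10000) 0)
    (hK : FamilyCoverGRecAt 𝓘₀ (26 / 5) (1 / 100))
    (hD : RefineGBRecByAt 𝓘₀ 𝓘 (26 / 5) (1 / 100) (recordGradedBox ηP ηW) (recordGradedSlope ηP ηW)) :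
    CoreOffTubeFloor (63 / 10) (63 / 10) (26 / 5) (1 / 100) 0 :=
  coreOff_26_5_of_pairTubeRecBy (tubeFloorGBRecBy_recordGraded_of_cells h₁ h₂ h₃) hK hD

/-- ★ The crux BY NAME from the host-graded record cells (hypotheses = those of the tree junction
`aperiodicFrustratedLawGap_of_homFloor_625_of_pairTubeRecBy` with `hTF` replaced by the three E-cells). -/
theorem aperiodicFrustratedLawGap_of_homFloor_625_of_recordGraded {εE CE DE DX ηP ηW : ℝ} {𝓘₀ 𝓘 : ChartFam}
    (hε0 : 0 < εE) (hε1 : εE ≤ 1 / 10000) (hU : PeriodicEnergyCeiling (-(7175 / 10000))) (hDX : 0 ≤ DX)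
    (hE : SchurElasticPricingX (1 / 20) (1 / 8) w₄₅ ω₄ (3 / 400) (-(7175 / 10000)) (1 / 10000) CE DE DX (LocOptFails eStar εE (3 / 2) 1))
    (hHF : HomFloor (1 / 625)) (hTP : TailPenalty (24 / 5) (1 / 1000)) (hRl : CoreCoreRelief (63 / 10) (63 / 10) (24 / 5) (1 / 100) (3 / 5000))
    (h₁ : TubeFloorGBRec (fun M₀ z₀ c₀ => 𝓘 M₀ z₀ c₀ ∧ lowLevel ηP M₀ z₀ c₀) (197 / 10000) (49 / 5000))
    (h₂ : TubeFloorGBRec (fun M₀ z₀ c₀ => (𝓘 M₀ z₀ c₀ ∧ ¬lowLevel ηP M₀ z₀ c₀) ∧ fccCentred ηW M₀ z₀ c₀) (131 / 10000) (131 / 20000))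
    (h₃ : TubeFloorGBRec (fun M₀ z₀ c₀ => (𝓘 M₀ z₀ c₀ ∧ ¬lowLevel ηP M₀ z₀ c₀) ∧ ¬fccCentred ηW M₀ z₀ c₀) (239 / 10000) 0)
    (hK : FamilyCoverGRec 𝓘₀) (hDG : RefineGBRecBy 𝓘₀ 𝓘 (recordGradedBox ηP ηW) (recordGradedSlope ηP ηW))
    (hF : AnnularPhaseFloor (63 / 10) (24 / 5) (63 / 10) (1 / 1000))
    (hP : PolyTextureFloor (63 / 10) (24 / 5) (1 / 1000)) (hA : AnnularDefectFloor (24 / 5) (63 / 10)) (hD : DefectiveCollarFloor (24 / 5))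
    (h2 : CrowdedCoreMotifPricingCapK (1 / 1000) (9 / 5) (133 / 10) (3 / 2) (effPot w₄₅ ω₄ (3 / 400)) (-(7175 / 10000) + 3 / 400)
      (Collar (9 / 2) fun N y j => (∃ s : ℝ, 0 ≤ s ∧ s ≤ 3 / 2 ∧ NonEquilibriumCore (-(7175 / 10000)) 0 7 s (1 / 10000) N y j) ∨
        GoodAtScale (1 / 20) (3 / 2) y j))
    (h3 : DiluteDefectMotifPricingCapK (1 / 1000) (9 / 5) (133 / 10) (3 / 2) (effPot w₄₅ ω₄ (3 / 400)) (-(7175 / 10000) + 3 / 400)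
      (Collar (9 / 2) fun N y j => (∃ s : ℝ, 0 ≤ s ∧ s ≤ 3 / 2 ∧ NonEquilibriumCore (-(7175 / 10000)) 0 7 s (1 / 10000) N y j) ∨
        GoodAtScale (1 / 20) (3 / 2) y j)) :
    Summit.AtomisticToContinuum.Crystallization.Theses.FrustratedLawDichotomy.AperiodicFrustratedLawGap :=
  aperiodicFrustratedLawGap_of_homFloor_625_of_pairTubeRecBy hε0 hε1 hU hDX hE hHF hTP hRl
    (tubeFloorGBRecBy_recordGraded_of_cells h₁ h₂ h₃) hK hDG hF hP hA hD h2 h3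

end Summit.AtomisticToContinuum.Crystallization.Theorems.FrustratedLawDichotomyStrainedPatchPairTube

end
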